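import Mathlib

/-!
# Solo (informed) rung s27/1: spot counts of the two-strand model

Setting (paper §16.13(h)(5′), (10) and §16.13(i)): for the Kummer extension `L = K(η^{1/7})`
of `K = F(ζ₇)` over a standard totally real cubic field `F` with `7` inert, the class module
`Cl(L)/7` is the sum of two Jordan strands of `T = g - 1` (`⟨g⟩ = Gal(L/K)`) with top
`Δ = Gal(K/F)`-characters `ω³`, `ω⁵`, lengths `ℓ₃, ℓ₅ ∈ [1, 7]`, and character `ω^{t+d}` at
depth `d < ℓ_t` of the strand with top `ω^t`.  Three bookkeeping statements of the model are
used as registered predictions; they are finite combinatorics in the lengths and are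
certified here.

* `soloInformed_spots_order_three`: the number of pairs (strand, depth) whose character is
  trivial on the subgroup of `Δ` of order `3` (`3 ∣ t + d`) — in the model, the `7`-rank of
  the class group of the degree-`42` field `F_η(√-7)` — is
  `1 + [ℓ₃ ≥ 4] + [ℓ₃ = 7] + [ℓ₅ ≥ 2] + [ℓ₅ ≥ 5] = rank₇ Cl(F_η) + 1 + [ℓ₃ = 7] + [ℓ₅ ≥ 5]`
  (prediction P44).
* `soloInformed_spots_order_two`: for the subgroup of order `2` (`2 ∣ t + d`; the degree-`63`
  field `K⁺(η^{1/7})`) a strand of length `ℓ` with odd top exponent contributes `⌊ℓ/2⌋`.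
* `soloInformed_sha_count`: the number of `Γ = Gal(L/F)`-equivariant maps from the two
  strands onto pieces of the uniserial module `Fil_k/Fil_0 = [ω^{-k}; …; ω^{-1}]`
  (`1 ≤ k ≤ 5`; a map whose image has colength `i < k` needs top character
  `ω^{-k+i} = ω^t` and `ℓ_t ≥ k - i`) equals `1 + [k ≥ 3]·[ℓ₃ ≥ 3]`.  Through the
  Shapiro–CFT dictionary of §16.13(i) this number is `dim Ш¹(G_{F,S}, Fil_k^η/Fil_0)`, and at
  `k = 3`, where the cokernel formula gives `2 - r₀(η)`, it is LAW U: `r₀(η) = 0 ↔ ℓ₃(η) ≥ 3`.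
-/

namespace Summit.Langlands.Langlands.Theorems

open Finset

/-- Degree `42`: spots with `3 ∣ t + d` on the strands with tops `ω³` (length `ℓ₃`) and `ω⁵`
(length `ℓ₅`). -/
theorem soloInformed_spots_order_three :
    ∀ ℓ₃ ∈ Icc 1 7, ∀ ℓ₅ ∈ Icc 1 7,
      ((range ℓ₃).filter (fun d => (3 + d) % 3 = 0)).card
        + ((range ℓ₅).filter (fun d => (5 + d) % 3 = 0)).card
      = 1 + (if 4 ≤ ℓ₃ then 1 else 0) + (if ℓ₃ = 7 then 1 else 0)
          + (if 2 ≤ ℓ₅ then 1 else 0) + (if 5 ≤ ℓ₅ then 1 else 0) := by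
  decide

/-- Degree `63`: spots with `2 ∣ t + d` for an odd top exponent `t`: `⌊ℓ/2⌋` per strand. -/
theorem soloInformed_spots_order_two :
    ∀ t ∈ ({3, 5} : Finset ℕ), ∀ ℓ ≤ 7,
      ((range ℓ).filter (fun d => (t + d) % 2 = 0)).card = ℓ / 2 := by
  decide

/-- `dim Ш¹(G_{F,S}, Fil_k^η/Fil_0) = 1 + [k ≥ 3]·[ℓ₃ ≥ 3]` for `1 ≤ k ≤ 5`: count the
colengths `i < k` with top character `ω^{6-k+i} ∈ {ω³, ω⁵}` carried by a strand of length at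
least `k - i`. -/
theorem soloInformed_sha_count :
    ∀ k ∈ Icc 1 5, ∀ ℓ₃ ∈ Icc 1 7, ∀ ℓ₅ ∈ Icc 1 7,
      ((range k).filter (fun i =>
          ((6 - k + i) % 6 = 3 ∧ k - i ≤ ℓ₃) ∨ ((6 - k + i) % 6 = 5 ∧ k - i ≤ ℓ₅))).card
        = 1 + (if 3 ≤ k ∧ 3 ≤ ℓ₃ then 1 else 0) := by
  decide

end Summit.Langlands.Langlands.Theorems
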